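import Mathlib
import HarnessLib

/-!
# The linear Cauchy–Davenport inequality and the linear Vosper theorem over an algebraically
# closed base field (Eliahou–Lecouvey; Bachoc–Serra–Zémor)

Topic `Literature/Combinatorics/Additive` (linear analogues of addition theorems: dimensions of
subspaces `S, T` of a field extension `L/F` and of the `F`-span `ST` of the products; companion
of `LinearKneser.lean`, whose docstring lists exactly these two statements as "Not here").

Source (held, read 2026-08-15 on the arXiv version): C. Bachoc, O. Serra, G. Zémor, *An analogue
of Vosper's theorem for extension fields*, Math. Proc. Cambridge Philos. Soc. 163 (2017) 423–452
= arXiv:1501.00602 [BachocSerraZemor2017].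

* `LinearCauchyDavenport` — loc. cit. Theorem 2 (p. 2, credited there to Eliahou–Lecouvey 2009,
  Thm 6.2, "obtained in full generality, without the separability hypothesis"), verbatim:
  "Let `L/F` be an extension with no proper finite intermediate extension. For every pair of
  subspaces `S, T ⊂ L` of finite dimension, `dim(ST) ≥ min{dim(L), dim(S) + dim(T) − 1}`."
* `LinearVosperAlgClosed` — loc. cit. Theorem 34 (§7 "Transcendental extensions", p. 16),
  verbatim: "Let `F` be an algebraically closed field and let `L/F` be a non-trivial extension of
  `F`. Let `S, T` be subspaces of `L` such that `dim(S) ≥ 2, dim(T) ≥ 2` and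
  `dim(ST) = dim(S) + dim(T) − 1`. Then there are bases of `S` and `T` of the form
  `{g, ga, …, ga^{dim(S)−1}}` and `{g′, g′a, …, g′a^{dim(T)−1}}` for some `g, g′, a ∈ L`."
  (The paper's main Theorem 3 is the finite-field, prime-degree case and is NOT vendored here;
  p. 2 records that its conclusion FAILS for some extensions with no finite intermediate
  extension when `F` is not finite — the algebraically closed case is the one that holds in
  general, by the valuation argument of §7.)

Rendering notes.
* `ST` is Mathlib's product `S * T` of submodules of the `F`-algebra `L` (the span of the
  products), as in `LinearKneser.lean`.
* Theorem 2 is stated in print for nonempty-set-like data; for `S = 0` (or `T = 0`) the displayed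
  inequality is void (`ST = 0` while `dim T − 1` may be positive), so — exactly as for
  `LinearKneser` — the fact carries `S ≠ ⊥`, `T ≠ ⊥`. `dim(L)` may be infinite, so that side is a
  `Module.rank` (cardinal); "no proper finite intermediate extension" is rendered on
  `IntermediateField F L` as "every intermediate field finite-dimensional over `F` is `⊥` or `⊤`"
  (so finite `L/F` of prime degree qualify, as in print).
* In Theorem 34, "bases of the form `{g, ga, …, ga^{d−1}}`" with `d = dim S` is rendered as "the
  `d` vectors `g aⁱ (i < d)` span `S`" — a spanning family of `finrank` many vectors is a basis, so
  nothing is lost; "non-trivial extension" is rendered as `⊥ ≠ ⊤` in `Subalgebra F L` (it is in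
  any case implied by `dim S ≥ 2`).

Grounds route MatrixMultiplication/FieldSumsetRank (2026-08-15): items
`Summit.MatrixMultiplication.MatrixMultiplication.Theses.FieldSumsetRank.TwoByTwoHostingEight`
(stmt-MatrixMultiplication-8741: in `ℂ(t)/ℂ` — indeed already in `ℂ[t]` — two 4-dimensional
spaces have `dim V₁V₂ ≥ 7` by `LinearCauchyDavenport`/`LinearKneser`, and `= 7` forces dilated
geometric progressions by `LinearVosperAlgClosed`, which the route's Hankel "Lemma A" then
excludes) and `…TwoByTwoHostingNine` (stmt-8735, one step above the Vosper boundary). Mathlib has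
the group versions (`Mathlib/Combinatorics/Additive/`, `ZMod.min_le_card_add`, Kneser) but no
field-extension analogue (`lean search Vosper`: nothing, 2026-08-15).

Nothing is asserted; users take `(h : LinearCauchyDavenport)` / `(h : LinearVosperAlgClosed)`.

## References
* [BachocSerraZemor2017] C. Bachoc, O. Serra, G. Zémor, *An analogue of Vosper's theorem for
  extension fields*, Math. Proc. Cambridge Philos. Soc. 163 (2017) 423–452 = arXiv:1501.00602,
  Theorem 2 (p. 2) and Theorem 34 (§7, p. 16).
* [EliahouLecouvey2009] S. Eliahou, C. Lecouvey, *On linear versions of some addition theorems*,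
  Linear Multilinear Algebra 57 (2009) 759–775, Thm 6.2 (as credited in [BachocSerraZemor2017],
  p. 2; not re-read here).
-/

namespace Literature.Combinatorics.Additive

/-- **Linear Cauchy–Davenport inequality** (Bachoc–Serra–Zémor 2017, Theorem 2, crediting
Eliahou–Lecouvey 2009 Thm 6.2): let `L/F` be a field extension with no proper finite
intermediate extension (every intermediate field finite-dimensional over `F` is `F` or `L`; this
covers both the finite extensions of prime degree singled out in print and infinite-dimensional
`L/F` such as `ℂ(t)/ℂ`, where it says that no intermediate field other than `F` is finite over
`F`). Then
for all nonzero finite-dimensional `F`-subspaces `S, T ⊆ L`,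
`dim_F(ST) ≥ min{dim_F L, dim_F S + dim_F T − 1}`,
where `ST = S * T` is the span of the products and `dim_F L` is a cardinal (possibly infinite).
(`S, T ≠ 0` is implicit in print; see the module docstring.) Named fact; users take
`(h : LinearCauchyDavenport)`. [cite: BachocSerraZemor2017, Thm 2 (p. 2)] -/
def LinearCauchyDavenport : Prop :=
  ∀ (F L : Type) [Field F] [Field L] [Algebra F L],
    (∀ K : IntermediateField F L, FiniteDimensional F K → K = ⊥ ∨ K = ⊤) →
      ∀ (S T : Submodule F L), FiniteDimensional F S → FiniteDimensional F T → S ≠ ⊥ → T ≠ ⊥ →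
        min (Module.rank F L) ((Module.finrank F S + Module.finrank F T - 1 : ℕ) : Cardinal) ≤
          Module.rank F ↥(S * T)

/-- **Linear Vosper theorem over an algebraically closed base field** (Bachoc–Serra–Zémor 2017,
Theorem 34): let `F` be algebraically closed and `L/F` a non-trivial field extension; let
`S, T ⊆ L` be finite-dimensional `F`-subspaces with `dim S ≥ 2`, `dim T ≥ 2` and
`dim(ST) = dim S + dim T − 1`. Then there are `g, g', a ∈ L` such that
`{g, ga, …, ga^{dim S − 1}}` is a basis of `S` and `{g', g'a, …, g'a^{dim T − 1}}` is a basis of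
`T` (rendered: these `dim S`, resp. `dim T`, vectors span `S`, resp. `T`). Named fact; users take
`(h : LinearVosperAlgClosed)`. [cite: BachocSerraZemor2017, Thm 34 (§7, p. 16)] -/
def LinearVosperAlgClosed : Prop :=
  ∀ (F L : Type) [Field F] [IsAlgClosed F] [Field L] [Algebra F L],
    (⊥ : Subalgebra F L) ≠ ⊤ →
      ∀ (S T : Submodule F L), FiniteDimensional F S → FiniteDimensional F T →
        2 ≤ Module.finrank F S → 2 ≤ Module.finrank F T →
          Module.finrank F ↥(S * T) = Module.finrank F S + Module.finrank F T - 1 →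
            ∃ g g' a : L,
              Submodule.span F (Set.range fun i : Fin (Module.finrank F S) => g * a ^ (i : ℕ)) = S ∧
                Submodule.span F (Set.range fun i : Fin (Module.finrank F T) => g' * a ^ (i : ℕ)) = T

/-- Sanity consequence fixing the reading of the binders of `LinearVosperAlgClosed`: under its
hypotheses the common ratio `a` can be chosen together with generators `g ∈ S` (the `i = 0`
vector of the spanning family lies in `S`). [cite: BachocSerraZemor2017, Thm 34 (§7, p. 16)] -/
theorem LinearVosperAlgClosed.exists_mem (h : LinearVosperAlgClosed) (F L : Type) [Field F]
    [IsAlgClosed F] [Field L] [Algebra F L] (hL : (⊥ : Subalgebra F L) ≠ ⊤) (S T : Submodule F L)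
    [FiniteDimensional F S] [FiniteDimensional F T] (hS : 2 ≤ Module.finrank F S)
    (hT : 2 ≤ Module.finrank F T)
    (hST : Module.finrank F ↥(S * T) = Module.finrank F S + Module.finrank F T - 1) :
    ∃ g a : L, g ∈ S ∧ g * a ∈ S := by
  obtain ⟨g, g', a, hgS, -⟩ := h F L hL S T inferInstance inferInstance hS hT hST
  refine ⟨g, a, ?_, ?_⟩
  · rw [← hgS]
    refine Submodule.subset_span ⟨⟨0, by omega⟩, ?_⟩
    simp
  · rw [← hgS]
    refine Submodule.subset_span ⟨⟨1, by omega⟩, ?_⟩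
    simp

end Literature.Combinatorics.Additive
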